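import Summits.HodgeConjecture.HodgeConjecture.Theorems.F0P3cStCharTSTubeNewtonStep      -- ★ (J5b)(J5a₀) (this seat): `exists_refine_conj_approx`, `exists_conj_approx_base`; brings (J4c), ★ (J3)(J3⁻), ★ (L5)
import Literature.Topology.Algebra.CompactImageApproximationClosure                       -- ★ p851737 (LH4-p02 g8) (J5a∕c): `mem_image_of_isCompact_of_forall_exists_mem_leftCoset`
import Literature.NumberTheory.Automorphic.CMTorusRegularAEPrelims                        -- ★ `isClosed_torusU_of_t1Space`
import HarnessLib

/-!
# F0 · P3c · line LH6 «StCharTS» — ROAD «JAC-LOC» brick (J5c) «ORBIT ⊇ (INDUCTION + CLOSURE)»: every point of `s·P̃` is a conjugate `k s τ k⁻¹` with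
# `k ∈ K_γ`, `τ ∈ T ∩ K_γ`, for a REGULAR split-torus element `s` of `U(Φ₃)(K)` over a non-archimedean local field (Harish-Chandra 1970 Lemma 22)

Cell `pub/hodgecm-mathlib`, crux H413 = `stmt-HodgeConjecture-24833` (lane `--supports … --as helper`), route HCCMUnconditional; seat LH6-p03 (g5), holder of the road
«JAC-LOC» (memo `F0/P3b/LH6-p03/g5/ROAD-JAC-LOC.v2.LH6p03g5.md` §5 «PLAN v2», CLAIM C).  THEOREMS ONLY, sorry-free, no definition ∕ instance ∕ notation ∕ named fact.

SETTING = ★ (J4c)∕(J5b)'s model, now over a non-archimedean LOCAL field `K` (`[IsNonarchimedeanLocalField K]`, `σ` continuous and isometric), so that the levels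
`K_δ := (congruenceGL 3 δ).comap U.subtype` are COMPACT open (★ `isCompact_isOpen_comap_congruenceGL`) and form a neighbourhood basis of `1`.

THE RESULT **`exists_conj_eq_of_schedule`**.  Fix the data of ★ `exists_conj_approx_base` (levels `γ ≤ γ′`, `γγ′ ≤ ε`, the depth conditions at radius `γ`, the subgroups
`B ≤ K_γ′`, `Bbar` whose carriers lie in the image boxes) and a LEVEL SCHEDULE `δ μ ρx ρy ρx′ ρy′ : ℕ → Γ` with `δ 0 = ε`, `δ (n+1) = μ n · γ`, the hypotheses of ★
`exists_refine_conj_approx` at every stage, and `K_{δ n} → 1` (`hbasis`).  Then for every `p = b̄ c b e` (`b̄ ∈ Bbar`, `c ∈ K_γ ∩ T`, `b ∈ B`, `e ∈ K_ε`):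
  **`∃ k ∈ K_γ, ∃ τ ∈ T ∩ K_γ, k s τ k⁻¹ = s · p`** — `s·P̃ ⊆ Ad(K_γ)(s·T_γ)`, the converse of ★ (J4c).
PROOF: by induction (base ★ `exists_conj_approx_base`, step ★ `exists_refine_conj_approx`) there are, for every `n`, `kₙ ∈ K_γ`, `τₙ ∈ T ∩ K_γ` with
`(kₙ s τₙ kₙ⁻¹)⁻¹ (s p) ∈ K_{δ n}`; the map `(k, τ) ↦ k s τ k⁻¹` is continuous on the COMPACT set `K_γ × (K_γ ∩ T)`, so its image is closed and contains `s p`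
(★ p851737 `mem_image_of_isCompact_of_forall_exists_mem_leftCoset`).

HONEST LABEL: count-neutral for the road «JAC-LOC» (hyperbolic half of the print residue «WIF» of the (S-𝔇) organ `stub_EllipticPackage`); closes no organ.  HC_CM is
proved only modulo the 7 printed citations (2 remaining: hLiu418 = `stmt-HodgeConjecture-24832`, h413 = `stmt-HodgeConjecture-24833`) until rung 0 closes.

## References
* [HarishChandra1970] Harish-Chandra, *Harmonic analysis on reductive p-adic groups*, LNM 162 (1970), Lemma 22.
* [Casselman1995] W. Casselman, *Introduction to the theory of admissible representations of p-adic reductive groups* (1995), §1.4, Prop. 1.4.4.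
* [BourbakiGT1] N. Bourbaki, *General Topology* I, Ch. I §9 n° 4 (compact images are closed).
-/

set_option autoImplicit false
-- the mandated namespace has the single-problem summit's repeated segment (`HodgeConjecture.HodgeConjecture`)
set_option linter.dupNamespace false

open Matrix ValuativeRel Filter Topology Set
open Literature.NumberTheory.Automorphic Literature.NumberTheory.Automorphic.UnitaryGroup Literature.NumberTheory.Automorphic.UnitaryGroup.HeisRing
open Literature.NumberTheory.Rogawski1990 Literature.Topology.Algebra
open Summit.HodgeConjecture.HodgeConjecture.Cruxes.H413.F0P3cStCharTSTubeNewtonStep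
open scoped MatrixGroups Pointwise

namespace Summit.HodgeConjecture.HodgeConjecture.Cruxes.H413.F0P3cStCharTSTubeOrbitSurj

variable {K : Type*} [Field K] [ValuativeRel K] [TopologicalSpace K] [IsNonarchimedeanLocalField K]
  (σ : K →+* K) (hσ : ∀ x, σ (σ x) = x) [Invertible (2 : K)]
  {J : Matrix (Fin 3) (Fin 3) K} (hJ : J = (StdForm.antidiagonal 3).over K)

include hσ in
/-- **(J5c) ORBIT ⊇.**  See the module docstring. [cite: HarishChandra1970, Lemma 22] [cite: Casselman1995, Prop. 1.4.4] [cite: BourbakiGT1, Ch. I §9 n° 4] -/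
theorem exists_conj_eq_of_schedule (hσc : Continuous σ) (hv : ∀ x, valuation K (σ x) = valuation K x)
    (s : ↥(torusU σ J)) (hreg : IsRegularElt ((s : ↥(unitaryGroupOfForm σ J)) : GL (Fin 3) K))
    {d : Fin 3 → Kˣ} (hd : glDiagonal 3 K d = ((s : ↥(unitaryGroupOfForm σ J)) : GL (Fin 3) K))
    {γ γ' ε : ValueGroupWithZero K} (hγ0 : γ ≠ 0) (hγ1 : γ < 1) (hγγ' : γ ≤ γ') (hε : γ * γ' ≤ ε) (h2γ : valuation K (⅟(2 : K)) * γ ≤ 1)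
    (hρ : valuation K (⅟(2 : K)) * valuation K ((((d 0)⁻¹ * d 1 : Kˣ) : K) - σ (((d 0)⁻¹ * d 1 : Kˣ) : K)) * (γ * γ) ≤
      valuation K ((((d 0)⁻¹ * d 2 : Kˣ) : K) - 1) * γ)
    (hρw : valuation K (⅟(2 : K)) * valuation K ((((d 2)⁻¹ * d 1 : Kˣ) : K) - σ (((d 2)⁻¹ * d 1 : Kˣ) : K)) * (γ * γ) ≤
      valuation K ((((d 2)⁻¹ * d 0 : Kˣ) : K) - 1) * γ)
    -- the level schedule
    (δ μ ρx ρy ρx' ρy' : ℕ → ValueGroupWithZero K) (hδ0 : δ 0 = ε) (hδsucc : ∀ n, δ (n + 1) = μ n * γ)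
    (hδ1 : ∀ n, δ n < 1) (h2δ : ∀ n, valuation K (⅟(2 : K)) * δ n ≤ 1) (hδγ : ∀ n, δ n ≤ γ) (hμγ : ∀ n, μ n ≤ γ)
    (hρxμ : ∀ n, ρx n ≤ μ n) (hρyμ : ∀ n, ρy n ≤ μ n) (hρx'μ : ∀ n, ρx' n ≤ μ n) (hρy'μ : ∀ n, ρy' n ≤ μ n)
    (hρxδ : ∀ n, valuation K ((((d 0)⁻¹ * d 1 : Kˣ) : K) - 1) * ρx n = δ n) (hρyδ : ∀ n, valuation K ((((d 0)⁻¹ * d 2 : Kˣ) : K) - 1) * ρy n = δ n)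
    (hρx'δ : ∀ n, valuation K ((((d 2)⁻¹ * d 1 : Kˣ) : K) - 1) * ρx' n = δ n) (hρy'δ : ∀ n, valuation K ((((d 2)⁻¹ * d 0 : Kˣ) : K) - 1) * ρy' n = δ n)
    (hρn : ∀ n, valuation K (⅟(2 : K)) * valuation K ((((d 0)⁻¹ * d 1 : Kˣ) : K) - σ (((d 0)⁻¹ * d 1 : Kˣ) : K)) * (ρx n * ρx n) ≤
      valuation K ((((d 0)⁻¹ * d 2 : Kˣ) : K) - 1) * ρy n)
    (hρwn : ∀ n, valuation K (⅟(2 : K)) * valuation K ((((d 2)⁻¹ * d 1 : Kˣ) : K) - σ (((d 2)⁻¹ * d 1 : Kˣ) : K)) * (ρx' n * ρx' n) ≤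
      valuation K ((((d 2)⁻¹ * d 0 : Kˣ) : K) - 1) * ρy' n)
    (hδμ : ∀ n, δ n ≤ μ n) (h2μ : ∀ n, valuation K (⅟(2 : K)) * μ n ≤ 1)
    (hbasis : ∀ W ∈ 𝓝 (1 : ↥(unitaryGroupOfForm σ J)), ∃ n, (((congruenceGL 3 (δ n)).comap (unitaryGroupOfForm σ J).subtype :
      Subgroup ↥(unitaryGroupOfForm σ J)) : Set ↥(unitaryGroupOfForm σ J)) ⊆ W)
    -- (L1) reverse, the subgroups `B`, `Bbar`
    (hL1rev : ∀ (η : ValueGroupWithZero K) (n : ↥(unipotentU σ J)), valuation K (⅟(2 : K)) * η ≤ 1 →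
      valuation K (heisX σ n) ≤ η → valuation K (heisY σ hσ hJ n : K) ≤ η →
        (n : ↥(unitaryGroupOfForm σ J)) ∈ (congruenceGL 3 η).comap (unitaryGroupOfForm σ J).subtype)
    (B Bbar : Subgroup ↥(unitaryGroupOfForm σ J))
    (hBK : B ≤ (congruenceGL 3 γ').comap (unitaryGroupOfForm σ J).subtype)
    (hBsub : ∀ g ∈ B, ∃ n : ↥(unipotentU σ J), (n : ↥(unitaryGroupOfForm σ J)) = g ∧
      valuation K (heisX σ n) ≤ valuation K ((((d 0)⁻¹ * d 1 : Kˣ) : K) - 1) * γ ∧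
        valuation K (heisY σ hσ hJ n : K) ≤ valuation K ((((d 0)⁻¹ * d 2 : Kˣ) : K) - 1) * γ)
    (hBbarsub : ∀ g ∈ Bbar, ∃ m : ↥(unipotentU σ J), weylLongU σ hJ * (m : ↥(unitaryGroupOfForm σ J)) * (weylLongU σ hJ)⁻¹ = g ∧
      valuation K (heisX σ m) ≤ valuation K ((((d 2)⁻¹ * d 1 : Kˣ) : K) - 1) * γ ∧
        valuation K (heisY σ hσ hJ m : K) ≤ valuation K ((((d 2)⁻¹ * d 0 : Kˣ) : K) - 1) * γ)
    {bb c b e : ↥(unitaryGroupOfForm σ J)} (hbb : bb ∈ Bbar)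
    (hcK : c ∈ (congruenceGL 3 γ).comap (unitaryGroupOfForm σ J).subtype) (hcT : c ∈ torusU σ J) (hb : b ∈ B)
    (he : e ∈ (congruenceGL 3 ε).comap (unitaryGroupOfForm σ J).subtype) :
    ∃ k ∈ (congruenceGL 3 γ).comap (unitaryGroupOfForm σ J).subtype, ∃ τ ∈ (congruenceGL 3 γ).comap (unitaryGroupOfForm σ J).subtype, τ ∈ torusU σ J ∧
      k * s * τ * k⁻¹ = (s : ↥(unitaryGroupOfForm σ J)) * (bb * c * b * e) := by
  -- (1) the induction: approximate solutions at every level `δ n`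
  have happrox : ∀ n : ℕ, ∃ k ∈ (congruenceGL 3 γ).comap (unitaryGroupOfForm σ J).subtype,
      ∃ τ ∈ (congruenceGL 3 γ).comap (unitaryGroupOfForm σ J).subtype, τ ∈ torusU σ J ∧
        (k * s * τ * k⁻¹)⁻¹ * ((s : ↥(unitaryGroupOfForm σ J)) * (bb * c * b * e)) ∈
          (congruenceGL 3 (δ n)).comap (unitaryGroupOfForm σ J).subtype := by
    intro n
    induction n with
    | zero =>
      rw [hδ0]
      exact exists_conj_approx_base σ hσ hJ hv s hreg hd hγ1.le hγγ' hε hρ hρw (fun n hx hy => hL1rev γ n h2γ hx hy)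
        B Bbar hBK hBsub hBbarsub hbb hcK hcT hb he
    | succ n ih =>
      obtain ⟨k, hk, τ, hτK, hτT, herr⟩ := ih
      obtain ⟨k', hk', τ', hτ'K, hτ'T, herr'⟩ := exists_refine_conj_approx σ hσ hJ hv s hreg hd hγ1.le (hδ1 n) (h2δ n) (hδγ n) (hμγ n)
        (hρxμ n) (hρyμ n) (hρx'μ n) (hρy'μ n) (hρxδ n) (hρyδ n) (hρx'δ n) (hρy'δ n) (hρn n) (hρwn n) (hδμ n) (h2μ n) hL1rev hk hτK hτT herr
      refine ⟨k', hk', τ', hτ'K, hτ'T, ?_⟩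
      rw [hδsucc n]
      have hcancel : k * s * τ * k⁻¹ * ((k * s * τ * k⁻¹)⁻¹ * ((s : ↥(unitaryGroupOfForm σ J)) * (bb * c * b * e))) =
          (s : ↥(unitaryGroupOfForm σ J)) * (bb * c * b * e) := mul_inv_cancel_left _ _
      rw [hcancel] at herr'
      exact herr'
  -- (2) compactness of `K_γ × (K_γ ∩ T)` and continuity of `(k, τ) ↦ k s τ k⁻¹`
  haveI : T2Space K := (Literature.NumberTheory.GaloisRepresentations.IsNonarchimedeanLocalField.isLocalField K).toT2Space
  have hKc := (isCompact_isOpen_comap_congruenceGL σ (J := J) hσc hγ0).1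
  have hTcl : IsClosed (torusU σ J : Set ↥(unitaryGroupOfForm σ J)) := isClosed_torusU_of_t1Space σ J
  set X : Set (↥(unitaryGroupOfForm σ J) × ↥(unitaryGroupOfForm σ J)) :=
    ((((congruenceGL 3 γ).comap (unitaryGroupOfForm σ J).subtype : Subgroup ↥(unitaryGroupOfForm σ J)) : Set ↥(unitaryGroupOfForm σ J))) ×ˢ
      (((((congruenceGL 3 γ).comap (unitaryGroupOfForm σ J).subtype : Subgroup ↥(unitaryGroupOfForm σ J)) : Set ↥(unitaryGroupOfForm σ J))) ∩
        (torusU σ J : Set ↥(unitaryGroupOfForm σ J))) with hX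
  have hXc : IsCompact X := hKc.prod (hKc.inter_right hTcl)
  have hfc : Continuous fun x : ↥(unitaryGroupOfForm σ J) × ↥(unitaryGroupOfForm σ J) => x.1 * (s : ↥(unitaryGroupOfForm σ J)) * x.2 * x.1⁻¹ :=
    ((continuous_fst.mul continuous_const).mul continuous_snd).mul continuous_fst.inv
  -- (3) the closure lemma
  have hmem := mem_image_of_isCompact_of_forall_exists_mem_leftCoset (X := ↥(unitaryGroupOfForm σ J) × ↥(unitaryGroupOfForm σ J)) hXc hfc.continuousOn
    (p := (s : ↥(unitaryGroupOfForm σ J)) * (bb * c * b * e))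
    (fun n : ℕ => ((((congruenceGL 3 (δ n)).comap (unitaryGroupOfForm σ J).subtype : Subgroup ↥(unitaryGroupOfForm σ J)) : Set ↥(unitaryGroupOfForm σ J))))
    hbasis (fun n => by
      obtain ⟨k, hk, τ, hτK, hτT, herr⟩ := happrox n
      refine ⟨(k, τ), ⟨hk, hτK, hτT⟩, ((k * s * τ * k⁻¹)⁻¹ * ((s : ↥(unitaryGroupOfForm σ J)) * (bb * c * b * e)))⁻¹, Subgroup.inv_mem _ herr, ?_⟩
      change (s : ↥(unitaryGroupOfForm σ J)) * (bb * c * b * e) * ((k * s * τ * k⁻¹)⁻¹ * ((s : ↥(unitaryGroupOfForm σ J)) * (bb * c * b * e)))⁻¹ =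
        k * (s : ↥(unitaryGroupOfForm σ J)) * τ * k⁻¹
      group)
  obtain ⟨⟨k, τ⟩, ⟨hk, hτK, hτT⟩, hkτ⟩ := hmem
  exact ⟨k, hk, τ, hτK, hτT, hkτ⟩

end Summit.HodgeConjecture.HodgeConjecture.Cruxes.H413.F0P3cStCharTSTubeOrbitSurj
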